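import Mathlib.Analysis.Calculus.Deriv.MeanValue
import Mathlib.Analysis.Calculus.Deriv.Inv
import HarnessLib

/-!
# Crux K2 `PoloidalWindowRigidity` (stmt-NavierStokesRegularity-19708), line `z_shock` — R3 inhabitant census: ROTATING PATTERNS (IX) —
# the FORCED one-sided Riccati kernel: forward blow-up under a divergent genuine-nonlinearity budget and an integrable source,
# exactly when the datum beats the remaining source budget (ODE kernel of census item F4)

`--supports stmt-NavierStokesRegularity-19708 --as helper` (leafhand-ns-poloidalwindowdoor-3 g9, cell decomp-ns, 2026-08-31).  Class-free real
analysis, Mathlib only.  **No stub and no summit is closed by this file; Navier–Stokes regularity is NOT proved here (rung 0).**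

WHY THIS FILE.  The tree's Riccati kernels (`…ZShockRiccatiTwoSided`, `…ZShockRiccatiDivergent`, `…ZShockOneEndedTools`) treat the EXACT law
`q' = −b q²` (two-sided Liouville, backward budgets).  The exterior radius-as-time problem of the rotating patterns (evidence #47 §2(c)) is
different in two ways: it is ONE-SIDED (the radius `r ≥ r₀` only increases) and it is FORCED — in `(r,θ)` the Riemann-derivative variable obeys
`q' ≤ −a(r) q² + f(r)` with the John-normalised genuine-nonlinearity coefficient `a ≍ r^{-1/2}` (`∫^∞ a = ∞`) and NON-AUTONOMOUS sources
`f = O(r^{-2})` (`∫^∞ |f| < ∞`).  The sources let decaying data survive (`q ≍ −r^{-3/4}`), so blow-up needs a datum of the bad sign that BEATS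
THE REMAINING SOURCE BUDGET.  This file proves exactly that ODE statement, with antiderivatives instead of integrals:

* ★ `riccati_forced_forward_noGlobal` — if `q' ≤ −a q² + f` on `[r₀, ∞)` with `a ≥ 0`, `A' = a`, `A` unbounded above on `[r₀, ∞)`,
  `f ≤ φ`, `0 ≤ φ`, `Φ' = φ`, `Φ ≤ Φ∞` on `[r₀, ∞)` and the datum satisfies `q(r₀) < Φ(r₀) − Φ∞` (i.e. `q(r₀) < −∫_{r₀}^∞ φ`), then there is
  NO such global `q`: `False`.  Proof: `q − Φ` is non-increasing, so `q ≤ −δ < 0` throughout (`δ = Φ(r₀) − Φ∞ − q(r₀)`); then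
  `g = −1/q + A − Φ/δ²` is non-increasing (`(−1/q)' = q'/q² ≤ −a + φ/δ²`), so `A ≤ g(r₀) + Φ∞/δ²` on `[r₀, ∞)` — contradicting divergence.
* `riccati_forced_global_witness` — SHARPNESS of the datum condition up to a factor 2: with `a ≡ 1` (`A(r) = r`, divergent) and the integrable
  source `f(r) = 2/(1+r)²` (`Φ(r) = −2/(1+r)`, `Φ∞ = 0`), the function `q(r) = −1/(1+r)` is a GLOBAL solution of `q' = −a q² + f` on `[0, ∞)` with
  the bad sign, and its datum `q(0) = −1` misses the blow-up threshold `Φ(0) − Φ∞ = −2`.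

How F4 would use it (recorded, not formalised): along an outgoing characteristic of the exterior `2×2` system the angular-derivative variable
satisfies the forced law with `∫ a = ∞` (John factor `r^{-1/2}`) and `∫ |f| < ∞`; the periodic zero-mean structure of `Ψ_θ` on circles
(parts IV–VI: flux, angular-momentum and energy circle laws) must supply, on every circle, a point whose datum beats the remaining source budget —
that quantitative step is the open part of F4.  [folklore] (comparison for Riccati inequalities; John 1974 §2; Hörmander 1997 §4.2)
-/

noncomputable section

namespace Summit.NavierStokesRegularity.NavierStokesRegularity.Theorems.PoloidalWindowDoorPoloidalWindowRigidityZShockRiccatiForced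

-- the summit and its single sub-problem share the name (CONVENTIONS §1)
set_option linter.dupNamespace false

open Set Filter Topology

/-- ★ **Forward blow-up for the forced Riccati inequality.**  On `[r₀, ∞)`: `q' ≤ −a q² + f`, `a ≥ 0` with an antiderivative `A`
unbounded above, `f ≤ φ` with `φ ≥ 0` and an antiderivative `Φ ≤ Φ∞`; if the datum beats the remaining source budget,
`q(r₀) < Φ(r₀) − Φ∞`, no such global `q` exists. [folklore] -/
theorem riccati_forced_forward_noGlobal {q q' a f φ Φ A : ℝ → ℝ} {r₀ Φinf : ℝ}
    (hq : ∀ r, r₀ ≤ r → HasDerivAt q (q' r) r)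
    (hineq : ∀ r, r₀ ≤ r → q' r ≤ -(a r * q r ^ 2) + f r)
    (ha : ∀ r, r₀ ≤ r → 0 ≤ a r) (hA : ∀ r, r₀ ≤ r → HasDerivAt A (a r) r)
    (hAup : ∀ K : ℝ, ∃ r, r₀ ≤ r ∧ K < A r)
    (hfφ : ∀ r, r₀ ≤ r → f r ≤ φ r) (hφ : ∀ r, r₀ ≤ r → 0 ≤ φ r)
    (hΦ : ∀ r, r₀ ≤ r → HasDerivAt Φ (φ r) r) (hΦbd : ∀ r, r₀ ≤ r → Φ r ≤ Φinf)
    (hdatum : q r₀ < Φ r₀ - Φinf) : False := by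
  -- the margin by which the datum beats the budget
  set δ : ℝ := Φ r₀ - Φinf - q r₀ with hδ
  have hδpos : 0 < δ := by rw [hδ]; linarith
  -- Step 1: `q − Φ` is non-increasing on `[r₀, ∞)`, hence `q ≤ −δ` there
  have hanti1 : AntitoneOn (fun r => q r - Φ r) (Ici r₀) := by
    refine antitoneOn_of_deriv_nonpos (convex_Ici r₀) (fun r hr => ?_) (fun r hr => ?_) fun r hr => ?_
    · exact ((hq r hr).sub (hΦ r hr)).continuousAt.continuousWithinAt
    · rw [interior_Ici] at hr
      exact ((hq r (le_of_lt hr)).sub (hΦ r (le_of_lt hr))).differentiableAt.differentiableWithinAt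
    · rw [interior_Ici] at hr
      have hd : HasDerivAt (fun r => q r - Φ r) (q' r - φ r) r := (hq r (le_of_lt hr)).sub (hΦ r (le_of_lt hr))
      rw [hd.deriv]
      have h1 := hineq r (le_of_lt hr)
      have h2 := hfφ r (le_of_lt hr)
      have h3 : 0 ≤ a r * q r ^ 2 := mul_nonneg (ha r (le_of_lt hr)) (sq_nonneg _)
      linarith
  have hqle : ∀ r, r₀ ≤ r → q r ≤ -δ := by
    intro r hr
    have h := hanti1 (self_mem_Ici : r₀ ∈ Ici r₀) (mem_Ici.2 hr) hr
    have h' := hΦbd r hr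
    simp only at h
    rw [hδ]
    linarith
  have hqneg : ∀ r, r₀ ≤ r → q r < 0 := fun r hr => (hqle r hr).trans_lt (by linarith)
  have hqne : ∀ r, r₀ ≤ r → q r ≠ 0 := fun r hr => (hqneg r hr).ne
  have hq2 : ∀ r, r₀ ≤ r → δ ^ 2 ≤ q r ^ 2 := by
    intro r hr
    have h : δ ≤ -q r := by linarith [hqle r hr]
    nlinarith [h, hδpos]
  -- Step 2: `g = −1/q + A − Φ/δ²` is non-increasing on `[r₀, ∞)`
  have hg : ∀ r, r₀ ≤ r → HasDerivAt (fun r => -(q r)⁻¹ + A r - Φ r / δ ^ 2)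
      (-(-(q' r) / q r ^ 2) + a r - φ r / δ ^ 2) r := by
    intro r hr
    have hinv : HasDerivAt (fun y => (q y)⁻¹) (-(q' r) / q r ^ 2) r := (hq r hr).inv (hqne r hr)
    exact (hinv.neg.add (hA r hr)).sub ((hΦ r hr).div_const (δ ^ 2))
  have hgle : ∀ r, r₀ ≤ r → -(-(q' r) / q r ^ 2) + a r - φ r / δ ^ 2 ≤ 0 := by
    intro r hr
    have hq2pos : 0 < q r ^ 2 := lt_of_lt_of_le (pow_pos hδpos 2) (hq2 r hr)
    have e1 : q' r / q r ^ 2 ≤ (-(a r * q r ^ 2) + φ r) / q r ^ 2 :=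
      div_le_div_of_nonneg_right (by linarith [hineq r hr, hfφ r hr]) hq2pos.le
    have e2 : (-(a r * q r ^ 2) + φ r) / q r ^ 2 = -a r + φ r / q r ^ 2 := by
      rw [add_div, neg_div, mul_div_assoc, div_self hq2pos.ne', mul_one]
    have e3 : φ r / q r ^ 2 ≤ φ r / δ ^ 2 := div_le_div_of_nonneg_left (hφ r hr) (pow_pos hδpos 2) (hq2 r hr)
    have e4 : -(-(q' r) / q r ^ 2) = q' r / q r ^ 2 := by ring
    linarith
  have hanti2 : AntitoneOn (fun r => -(q r)⁻¹ + A r - Φ r / δ ^ 2) (Ici r₀) := by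
    refine antitoneOn_of_deriv_nonpos (convex_Ici r₀) (fun r hr => ?_) (fun r hr => ?_) fun r hr => ?_
    · exact (hg r hr).continuousAt.continuousWithinAt
    · rw [interior_Ici] at hr
      exact (hg r (le_of_lt hr)).differentiableAt.differentiableWithinAt
    · rw [interior_Ici] at hr
      rw [(hg r (le_of_lt hr)).deriv]
      exact hgle r (le_of_lt hr)
  -- Step 3: `A` is bounded above on `[r₀, ∞)` — contradiction
  obtain ⟨r, hr, hK⟩ := hAup (-(q r₀)⁻¹ + A r₀ - Φ r₀ / δ ^ 2 + Φinf / δ ^ 2)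
  have h := hanti2 (self_mem_Ici : r₀ ∈ Ici r₀) (mem_Ici.2 hr) hr
  simp only at h
  have hinvneg : (q r)⁻¹ < 0 := inv_lt_zero.2 (hqneg r hr)
  have hΦr : Φ r / δ ^ 2 ≤ Φinf / δ ^ 2 := div_le_div_of_nonneg_right (hΦbd r hr) (pow_pos hδpos 2).le
  linarith

/-- **Sharpness of the datum condition (factor 2).**  `q(r) = −1/(1+r)` solves `q' = −1·q² + 2/(1+r)²` on `[0, ∞)`: divergent coefficient
`a ≡ 1` (`A(r) = r`), integrable source `f = 2/(1+r)²` (`Φ = −2/(1+r) ≤ 0 = Φ∞`), bad-sign datum `q(0) = −1`, which does NOT beat the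
budget `Φ(0) − Φ∞ = −2` — and the solution is global.  So `riccati_forced_forward_noGlobal` cannot drop its datum hypothesis. [folklore] -/
theorem riccati_forced_global_witness :
    (∀ r : ℝ, 0 ≤ r → HasDerivAt (fun r : ℝ => -(1 + r)⁻¹) ((1 + r) ^ 2)⁻¹ r) ∧
    (∀ r : ℝ, 0 ≤ r → ((1 + r) ^ 2)⁻¹ = -(1 * (-(1 + r)⁻¹) ^ 2) + 2 / (1 + r) ^ 2) ∧
    (∀ r : ℝ, 0 ≤ r → HasDerivAt (fun r : ℝ => -2 / (1 + r)) (2 / (1 + r) ^ 2) r) ∧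
    (∀ r : ℝ, 0 ≤ r → -2 / (1 + r) ≤ 0) ∧
    ¬ ((fun r : ℝ => -(1 + r)⁻¹) 0 < -2 / (1 + 0) - 0) := by
  refine ⟨fun r hr => ?_, fun r hr => ?_, fun r hr => ?_, fun r hr => ?_, by norm_num⟩
  · have h1 : HasDerivAt (fun r : ℝ => 1 + r) 1 r := by simpa using (hasDerivAt_id r).const_add 1
    have hne : (1 + r) ≠ 0 := by linarith
    have h2 := (h1.inv hne).neg
    refine h2.congr_deriv ?_
    rw [neg_div, neg_neg, one_div]
  · have hne : (1 + r) ≠ 0 := by linarith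
    field_simp
    ring
  · have h1 : HasDerivAt (fun r : ℝ => 1 + r) 1 r := by simpa using (hasDerivAt_id r).const_add 1
    have hne : (1 + r) ≠ 0 := by linarith
    have h2 := (h1.inv hne).const_mul (-2)
    have hfun : (fun r : ℝ => -2 / (1 + r)) = fun r => -2 * (1 + r)⁻¹ := funext fun r => div_eq_mul_inv _ _
    rw [hfun]
    refine h2.congr_deriv ?_
    rw [neg_div, one_div]
    ring
  · have hpos : 0 < 1 + r := by linarith
    exact div_nonpos_of_nonpos_of_nonneg (by norm_num) hpos.le

end Summit.NavierStokesRegularity.NavierStokesRegularity.Theorems.PoloidalWindowDoorPoloidalWindowRigidityZShockRiccatiForced
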